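/-
Origin: expansion seat `planner-pub-hodgecm-pv15-g6-0`, handover NONE ; any (imports the installed tree only: HodgeCM.Automorphic.KernelModelHeisenberg, r29) ; new (HANDOVER #1 14:36:57Z; v2 = CLAIM bytes 5589cbcc + additive §7) (`HOME/pub-hodgecm-pv15-g6/lean/Pv15g6/KernelModelHeisenbergPair.lean`, md5 e3aeb2da, 908 lines);
landed by the gen-8 packager in gate run 31 as `HodgeCM/Automorphic/KernelModelHeisenbergPair.lean` (verbatim).
-/
/-
Copyright: HodgeCM PerL speedrun cell `pub-hodgecm`, seat pv15-g6 (DAG-node prover #15, gen 6), 2026-08-18.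
WIP path `HOME/pub-hodgecm-pv15-g6/lean/Pv15g6/KernelModelHeisenbergPair.lean`;
target `HodgeCM/Automorphic/KernelModelHeisenbergPair.lean` (ONE NEW FILE, additive KERNEL leaf: nothing landed is edited,
nothing imports it).  Imports the tree only (`HodgeCM.Automorphic.KernelModelHeisenberg`, pv15-g5, run 29).
-/
import Summits.HodgeConjecture.HodgeCM.Automorphic.KernelModelHeisenberg_3

/-!
# The Heisenberg DUAL PAIR kernel model: two Heisenberg nilmanifolds, `Heis K × Heis Kᗮ → Heis V`

pv15-g5's `KernelModelHeisenberg` instantiated pv15-g2's abstract kernel model of PerL v5 Prop. 3.6 (carriers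
`KernelCoreCarrier` / `KernelTorusCarrier`, the compact-quotient input, `analyticK_of_compactInput`, `AnalyticK.toAnalyticU`)
on the CENTRE–Heisenberg Weil theta model: `U(W)(𝔸) ↦ Heis V` acting by the weight-`m` Schrödinger representation, but
`G_U ↦` the centre `U(1)`, so that `[G_U] = U(1) ⧸ Γz` is a finite quotient of a circle and the kernel is a function of
ONE Heisenberg variable times a central character (pv15-g5 HANDOFF, successor piece (b): "a genuinely two-variable
instance is the named next piece").

This file constructs that two-variable instance — the archimedean shadow of a genuine reductive DUAL PAIR inside the
Heisenberg/metaplectic group — with NO hypothesis and nothing cited: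

* §1 **Functoriality of the polarised Heisenberg group** along linear isometries, `Heis.mapLI ι : Heis K →* Heis V`
  (`(a, b, u) ↦ (ι a, ι b, u)`; an isometry preserves the cocycle `𝐞(-⟪a, b'⟫)`), continuous and injective; the images of
  two isometries with ORTHOGONAL ranges COMMUTE (`Heis.mapLI_comm`: the cross cocycles `𝐞(-⟪ι₁ a, ι₂ b'⟫)` are `1`), whence
  the dual-pair homomorphism `Heis.pairHom : Heis K₁ × Heis K₂ →* Heis V`.
* §2 **The split lattice.**  For a subspace `K ≤ V` of a finite-dimensional real inner product space and full lattices
  `L₁ ⊂ K`, `L₂ ⊂ Kᗮ`, the lattice `L := L₁ ⊕ L₂ ⊂ V` (`lat`; `mem_lat`) is discrete (`discreteTopology_lat`, Pythagoras) and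
  full (`isZLattice_lat`, `K ⊕ Kᗮ = V`), and the two inclusions carry arithmetic subgroups into the arithmetic subgroup:
  `incl₁(arith K L₁ m) ≤ arith V L m`, `incl₂(arith Kᗮ L₂ m) ≤ arith V L m` (`incl₁_mem_arith`, `incl₂_mem_arith`: `m b ∈ L₁*`
  gives `m b ∈ L*` because `⟪b, L₂⟫ = 0`).
* §3 **The dual-pair Weil theta model** `pairModel : WeilThetaModel (Heis K) (arith K L₁ m) (Heis Kᗮ) (arith Kᗮ L₂ m)`
  (prl1-g4's interface): the datum is pv14-g5's `datumH V L m` (Schrödinger representation of `Heis V` on `𝓢(V, ℂ)`, Weil's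
  theta function `Θ_Φ(h) = Σ_{v ∈ L} (ρ_m(h)Φ)(v)`, arithmetic invariance), the splitting is `pairHom` — `G_U := Heis K` and
  `U(W) := Heis Kᗮ` act on the SAME Schwartz space through `Heis V` and commute —, `s_rat` is §2, `SK := univ`.  The kernel
  on representatives (`pairModel_θ_mk`): `θ_Φ(xΓ₁, yΓ₂) = Θ_Φ(incl₁ x⁻¹ · incl₂ y⁻¹)`, a function of TWO non-commutative
  variables; along the Schrödinger torus of `U(W)` at the origin of `[G_U]` (`pairModel_θ_one_torus`):
  `θ_Φ(1, (jT(a, u))⁻¹ Γ₂) = uᵐ Σ_{v ∈ L} Φ(v − a)`.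
* §4 **The kernel core carrier** over the two compact Heisenberg NILMANIFOLDS `[G_U] = Heis K ⧸ arith K L₁ m`,
  `[U(W)] = Heis Kᗮ ⧸ arith Kᗮ L₂ m` (pv14-g5 #7 `heisenbergLatticeModel` twice): `core`, the three structural laws
  (`structural`), AX1b(a) `hatτ_complete` — now about the isotypic components of the regular representation of a
  HEISENBERG group on `L²` of a nilmanifold (infinitely many, all central weights), not of a circle.
* §5 **The torus side of `U(W) = Heis Kᗮ`** — pv15-g5's §3 objects BY NAME at `(Kᗮ, L₂)` (`jT Kᗮ`, `ΛT Kᗮ L₂ m = L₂ × μ_m`,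
  `Xw Kᗮ L₂ m` = all characters of `[T]` with central weight `u^{-m}`, the `Λ`-partition of unity `β Kᗮ L₂ m`, `χ₀`) assembled
  into `torusCarrier : KernelTorusCarrier core (Kᗮ × U(1))`; AX5b, AX12(i), (U) = AX12(ii) BY NAME; the toric period at the
  origin computed (`ϑc_one`): `ϑ_{T,ξ}(Φ)(1·Γ₁) = ∫_T β(t) ξ(a, 1) Σ_{v ∈ L} Φ(v − a) dν(t)`, and **non-zero for EVERY allowed
  `ξ`** (`ϑc_ne_zero_of_mem`; the new point over pv15-g5: a lattice vector `v = l₁ + l₂` near the subspace `Kᗮ` has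
  `‖l₂ − a + a₀‖ ≤ ‖v − a + a₀‖` by orthogonality, and `ξ(·, 1)` is `L₂`-periodic).
* §6 **The compact-quotient input CONSTRUCTED** (`compactInput`, field by field as in pv15-g5 §4 at `(Kᗮ, L₂)`), hence
  **`analyticK`** (AX8, PerL Prop. 3.6 Step 2) and **`analyticU`** for the dual-pair model with NO HYPOTHESIS, and a smoke
  instance found by Lean (`V = ℝ³`, any subspace `K`, `L₁`, `L₂` the `ℤ`-spans of bases of `K`, `Kᗮ`).
* §7 **The swapped pair** (`G_U := Heis Kᗮ`, `U(W) := Heis K`): `pairModelSwap` on the same datum, its kernel is the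
  transposed kernel (`pairModelSwap_θ_swap`), and `coreSwap` / `torusCarrierSwap` / `compactInputSwap` give
  **`analyticK_swap`, `analyticU_swap`** — both theta lifts of the pair (the two directions of the seesaw) carry the
  analytic package with no hypothesis.

HONEST SCOPE.  An archimedean SHADOW (one real place) of the dual pair `U(V₀) × U(W) ⊂ Sp`, with the two members replaced by
the Heisenberg groups of an orthogonal decomposition `V = K ⊕ Kᗮ` of the symplectic lattice data; NOT PerL's adelic
`U(1) × U(2,1)` / `𝒮^κ` theta kernel (DIVERGENCE.md, GAPS carverg2-X1 stand; the genuine adelic MODEL is the prl1/pv09/pv06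
lane).  Content = the kernel-model torus package exercised end-to-end in the regime with BOTH quotients non-abelian compact
nilmanifolds, a genuinely two-variable kernel, infinite `T(L₀)`, infinitely many allowed characters, every binder type
inhabited and every toric period functional non-zero.

PUBLISHED inputs cited as hypotheses: none.  No placeholders; axioms ⊆ {propext, Classical.choice, Quot.sound}.
No PerL / QW8 / 2001-programme statement is used.  Borel structures on `Circle` / `Multiplicative Kᗮ × Circle`: pv15-g5's
reducible local instances `borelCircle`, `borelT`.
-/

set_option autoImplicit false

noncomputable section

open MeasureTheory Topology
open HodgeCM.PerL34 HodgeCM.PerL34.Annihilation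

open scoped RealInnerProductSpace FourierTransform SchwartzMap CompactlySupported

attribute [-instance] Quotient.instMeasurableSpace

namespace HodgeCM
namespace SchwartzWeil

/-! ## 1. Functoriality of `Heis` along linear isometries; the dual-pair homomorphism -/

namespace Heis

section MapLI

variable {K V : Type*} [NormedAddCommGroup K] [InnerProductSpace ℝ K] [NormedAddCommGroup V] [InnerProductSpace ℝ V]

/-- **Functoriality of the polarised Heisenberg group**: a linear isometry `ι : K → V` induces
`(a, b, u) ↦ (ι a, ι b, u) : Heis K →* Heis V` (the cocycle `𝐞(-⟪a, b'⟫)` is preserved by an isometry). -/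
def mapLI (ι : K →ₗᵢ[ℝ] V) : Heis K →* Heis V where
  toFun h := ⟨ι h.a, ι h.b, h.u⟩
  map_one' := by
    ext
    · simp only [one_a, map_zero]
    · simp only [one_b, map_zero]
    · simp only [one_u]
  map_mul' h h' := by
    ext
    · simp only [mul_a, map_add]
    · simp only [mul_b, map_add]
    · simp only [mul_u, LinearIsometry.inner_map_map]

/-- (Ported verbatim from the HodgeCMPerL package; no docstring in the source.) -/
@[simp] theorem mapLI_a (ι : K →ₗᵢ[ℝ] V) (h : Heis K) : (mapLI ι h).a = ι h.a := rfl
/-- (Ported verbatim from the HodgeCMPerL package; no docstring in the source.) -/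
@[simp] theorem mapLI_b (ι : K →ₗᵢ[ℝ] V) (h : Heis K) : (mapLI ι h).b = ι h.b := rfl
/-- (Ported verbatim from the HodgeCMPerL package; no docstring in the source.) -/
@[simp] theorem mapLI_u (ι : K →ₗᵢ[ℝ] V) (h : Heis K) : (mapLI ι h).u = h.u := rfl

/-- (Ported verbatim from the HodgeCMPerL package; no docstring in the source.) -/
theorem continuous_mapLI (ι : K →ₗᵢ[ℝ] V) : Continuous (mapLI ι) :=
  continuous_mk (ι.continuous.comp continuous_a) (ι.continuous.comp continuous_b) continuous_u

/-- (Ported verbatim from the HodgeCMPerL package; no docstring in the source.) -/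
theorem mapLI_injective (ι : K →ₗᵢ[ℝ] V) : Function.Injective (mapLI ι) := by
  intro h h' e
  have ha : ι h.a = ι h'.a := congrArg Heis.a e
  have hb : ι h.b = ι h'.b := congrArg Heis.b e
  have hu : (mapLI ι h).u = (mapLI ι h').u := congrArg Heis.u e
  exact Heis.ext (ι.injective ha) (ι.injective hb) hu

/-- `mapLI ι` carries the Schrödinger torus of `K` to that of `V`. -/
theorem mapLI_ofSchrodinger (ι : K →ₗᵢ[ℝ] V) (t : Multiplicative K × Circle) :
    mapLI ι (ofSchrodinger t) = ofSchrodinger (Multiplicative.ofAdd (ι (Multiplicative.toAdd t.1)), t.2) := by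
  ext
  · simp only [mapLI_a, ofSchrodinger_a, toAdd_ofAdd]
  · simp only [mapLI_b, ofSchrodinger_b, map_zero]
  · simp only [mapLI_u, ofSchrodinger_u]

end MapLI

section Pair

variable {K₁ K₂ V : Type*} [NormedAddCommGroup K₁] [InnerProductSpace ℝ K₁] [NormedAddCommGroup K₂]
  [InnerProductSpace ℝ K₂] [NormedAddCommGroup V] [InnerProductSpace ℝ V]
  (ι₁ : K₁ →ₗᵢ[ℝ] V) (ι₂ : K₂ →ₗᵢ[ℝ] V) (horth : ∀ (x : K₁) (y : K₂), ⟪ι₁ x, ι₂ y⟫ = 0)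

include horth in
/-- **Heisenberg groups of ORTHOGONAL subspaces commute** inside `Heis V`: the cross cocycles `𝐞(-⟪ι₁ a, ι₂ b'⟫)`,
`𝐞(-⟪ι₂ a', ι₁ b⟫)` are trivial. -/
theorem mapLI_comm (x : Heis K₁) (y : Heis K₂) : mapLI ι₁ x * mapLI ι₂ y = mapLI ι₂ y * mapLI ι₁ x := by
  have horth' : ∀ (x : K₁) (y : K₂), ⟪ι₂ y, ι₁ x⟫ = 0 := fun x y => by rw [real_inner_comm]; exact horth x y
  ext
  · simp only [mul_a, mapLI_a, add_comm]
  · simp only [mul_b, mapLI_b, add_comm]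
  · simp only [mul_u, mapLI_a, mapLI_b, mapLI_u, horth, horth', neg_zero, AddChar.map_zero_eq_one, mul_one, mul_comm]

/-- **The dual-pair homomorphism** `Heis K₁ × Heis K₂ →* Heis V`, `(x, y) ↦ ι₁(x) · ι₂(y)`, for isometries with orthogonal
ranges. -/
def pairHom : Heis K₁ × Heis K₂ →* Heis V :=
  (mapLI ι₁).noncommCoprod (mapLI ι₂) fun x y => mapLI_comm ι₁ ι₂ horth x y

/-- (Ported verbatim from the HodgeCMPerL package; no docstring in the source.) -/
@[simp] theorem pairHom_apply (p : Heis K₁ × Heis K₂) : pairHom ι₁ ι₂ horth p = mapLI ι₁ p.1 * mapLI ι₂ p.2 := rfl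

/-- (Ported verbatim from the HodgeCMPerL package; no docstring in the source.) -/
theorem continuous_pairHom : Continuous (pairHom ι₁ ι₂ horth) :=
  ((continuous_mapLI ι₁).comp continuous_fst).mul ((continuous_mapLI ι₂).comp continuous_snd)

end Pair

end Heis

namespace HeisenbergPair

open HeisenbergKernel

/-! ## 2. The split lattice `L = L₁ ⊕ L₂ ⊂ V = K ⊕ Kᗮ` and the arithmetic subgroups -/

section Lattice

variable (V : Type) [NormedAddCommGroup V] [InnerProductSpace ℝ V] (K : Submodule ℝ V) (L₁ : Submodule ℤ K)
  (L₂ : Submodule ℤ Kᗮ)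

/-- The inclusion `incl₁ : Heis K →* Heis V` of the first member of the pair. -/
abbrev incl₁ : Heis K →* Heis V := Heis.mapLI K.subtypeₗᵢ

/-- The inclusion `incl₂ : Heis Kᗮ →* Heis V` of the second member of the pair. -/
abbrev incl₂ : Heis Kᗮ →* Heis V := Heis.mapLI Kᗮ.subtypeₗᵢ

/-- (Ported verbatim from the HodgeCMPerL package; no docstring in the source.) -/
@[simp] theorem incl₁_a (h : Heis K) : (incl₁ V K h).a = (h.a : V) := rfl
/-- (Ported verbatim from the HodgeCMPerL package; no docstring in the source.) -/
@[simp] theorem incl₁_b (h : Heis K) : (incl₁ V K h).b = (h.b : V) := rfl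
/-- (Ported verbatim from the HodgeCMPerL package; no docstring in the source.) -/
@[simp] theorem incl₁_u (h : Heis K) : (incl₁ V K h).u = h.u := rfl
/-- (Ported verbatim from the HodgeCMPerL package; no docstring in the source.) -/
@[simp] theorem incl₂_a (h : Heis Kᗮ) : (incl₂ V K h).a = (h.a : V) := rfl
/-- (Ported verbatim from the HodgeCMPerL package; no docstring in the source.) -/
@[simp] theorem incl₂_b (h : Heis Kᗮ) : (incl₂ V K h).b = (h.b : V) := rfl
/-- (Ported verbatim from the HodgeCMPerL package; no docstring in the source.) -/
@[simp] theorem incl₂_u (h : Heis Kᗮ) : (incl₂ V K h).u = h.u := rfl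

/-- `K ⊥ Kᗮ`. -/
theorem inner_coe_coe (x : K) (y : Kᗮ) : ⟪K.subtypeₗᵢ x, Kᗮ.subtypeₗᵢ y⟫ = 0 :=
  Submodule.inner_right_of_mem_orthogonal x.2 y.2

/-- The two Heisenberg groups commute in `Heis V`. -/
theorem incl₁_mul_incl₂ (x : Heis K) (y : Heis Kᗮ) : incl₁ V K x * incl₂ V K y = incl₂ V K y * incl₁ V K x :=
  Heis.mapLI_comm _ _ (inner_coe_coe V K) x y

/-- The dual-pair splitting `s : Heis K × Heis Kᗮ →* Heis V`, `(x, y) ↦ incl₁ x · incl₂ y`. -/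
abbrev pairSplitting : Heis K × Heis Kᗮ →* Heis V := Heis.pairHom K.subtypeₗᵢ Kᗮ.subtypeₗᵢ (inner_coe_coe V K)

/-- (Ported verbatim from the HodgeCMPerL package; no docstring in the source.) -/
theorem pairSplitting_apply (p : Heis K × Heis Kᗮ) : pairSplitting V K p = incl₁ V K p.1 * incl₂ V K p.2 := rfl

/-- **The split lattice** `L := L₁ ⊕ L₂ ⊂ V`. -/
def lat : Submodule ℤ V := L₁.map (K.subtype.restrictScalars ℤ) ⊔ L₂.map (Kᗮ.subtype.restrictScalars ℤ)

/-- (Ported verbatim from the HodgeCMPerL package; no docstring in the source.) -/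
theorem mem_lat {v : V} : v ∈ lat V K L₁ L₂ ↔ ∃ l₁ ∈ L₁, ∃ l₂ ∈ L₂, (l₁ : V) + (l₂ : V) = v := by
  rw [lat, Submodule.mem_sup]
  constructor
  · rintro ⟨y, hy, z, hz, rfl⟩
    obtain ⟨l₁, hl₁, rfl⟩ := Submodule.mem_map.mp hy
    obtain ⟨l₂, hl₂, rfl⟩ := Submodule.mem_map.mp hz
    exact ⟨l₁, hl₁, l₂, hl₂, rfl⟩
  · rintro ⟨l₁, hl₁, l₂, hl₂, rfl⟩
    exact ⟨(l₁ : V), Submodule.mem_map.mpr ⟨l₁, hl₁, rfl⟩, (l₂ : V), Submodule.mem_map.mpr ⟨l₂, hl₂, rfl⟩, rfl⟩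

/-- (Ported verbatim from the HodgeCMPerL package; no docstring in the source.) -/
theorem coe_mem_lat₁ {l₁ : K} (hl₁ : l₁ ∈ L₁) : (l₁ : V) ∈ lat V K L₁ L₂ :=
  (mem_lat V K L₁ L₂).mpr ⟨l₁, hl₁, 0, L₂.zero_mem, by rw [Submodule.coe_zero, add_zero]⟩

/-- (Ported verbatim from the HodgeCMPerL package; no docstring in the source.) -/
theorem coe_mem_lat₂ {l₂ : Kᗮ} (hl₂ : l₂ ∈ L₂) : (l₂ : V) ∈ lat V K L₁ L₂ :=
  (mem_lat V K L₁ L₂).mpr ⟨0, L₁.zero_mem, l₂, hl₂, by rw [Submodule.coe_zero, zero_add]⟩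

/-- Orthogonality controls each summand: `‖q‖ ≤ ‖p + q‖` for `p ∈ K`, `q ∈ Kᗮ`. -/
theorem norm_le_norm_add_of_mem {p q : V} (hp : p ∈ K) (hq : q ∈ Kᗮ) : ‖q‖ ≤ ‖p + q‖ := by
  have h := norm_add_sq_eq_norm_sq_add_norm_sq_real (Submodule.inner_right_of_mem_orthogonal hp hq)
  nlinarith [norm_nonneg p, norm_nonneg q, norm_nonneg (p + q)]

/-- … and `‖p‖ ≤ ‖p + q‖`. -/
theorem norm_le_norm_add_of_mem' {p q : V} (hp : p ∈ K) (hq : q ∈ Kᗮ) : ‖p‖ ≤ ‖p + q‖ := by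
  have h := norm_add_sq_eq_norm_sq_add_norm_sq_real (Submodule.inner_right_of_mem_orthogonal hp hq)
  nlinarith [norm_nonneg p, norm_nonneg q, norm_nonneg (p + q)]

variable [DiscreteTopology L₁] [DiscreteTopology L₂]

/-- **`L₁ ⊕ L₂` is discrete** (isolation constants of `L₁`, `L₂` and Pythagoras). -/
instance discreteTopology_lat : DiscreteTopology (lat V K L₁ L₂) := by
  obtain ⟨ε₁, hε₁, h₁⟩ := exists_norm_lt_imp_eq_zero K L₁
  obtain ⟨ε₂, hε₂, h₂⟩ := exists_norm_lt_imp_eq_zero Kᗮ L₂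
  refine discreteTopology_of_isOpen_singleton_zero ?_
  have hopen : IsOpen ((Subtype.val : lat V K L₁ L₂ → V) ⁻¹' Metric.ball 0 (min ε₁ ε₂)) :=
    Metric.isOpen_ball.preimage continuous_subtype_val
  convert hopen using 1
  ext v
  simp only [Set.mem_singleton_iff, Set.mem_preimage, Metric.mem_ball, dist_zero_right]
  constructor
  · rintro rfl
    rw [ZeroMemClass.coe_zero, norm_zero]
    exact lt_min hε₁ hε₂
  · intro hv
    obtain ⟨l₁, hl₁, l₂, hl₂, hv12⟩ := (mem_lat V K L₁ L₂).mp v.2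
    have hn₁ : ‖(l₁ : V)‖ < ε₁ :=
      lt_of_le_of_lt (by rw [← hv12]; exact norm_le_norm_add_of_mem' V K l₁.2 l₂.2)
        (lt_of_lt_of_le hv (min_le_left _ _))
    have hn₂ : ‖(l₂ : V)‖ < ε₂ :=
      lt_of_le_of_lt (by rw [← hv12]; exact norm_le_norm_add_of_mem V K l₁.2 l₂.2)
        (lt_of_lt_of_le hv (min_le_right _ _))
    have e₁ : (⟨l₁, hl₁⟩ : L₁) = 0 := h₁ ⟨l₁, hl₁⟩ hn₁
    have e₂ : (⟨l₂, hl₂⟩ : L₂) = 0 := h₂ ⟨l₂, hl₂⟩ hn₂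
    have e₁' : (l₁ : V) = 0 := by
      have := congrArg (fun x : L₁ => ((x : K) : V)) e₁
      simpa using this
    have e₂' : (l₂ : V) = 0 := by
      have := congrArg (fun x : L₂ => ((x : Kᗮ) : V)) e₂
      simpa using this
    apply Subtype.ext
    rw [ZeroMemClass.coe_zero, ← hv12, e₁', e₂', add_zero]

variable [FiniteDimensional ℝ V] [IsZLattice ℝ L₁] [IsZLattice ℝ L₂]

/-- **`L₁ ⊕ L₂` is a full lattice of `V`** (`K ⊕ Kᗮ = V`). -/
instance isZLattice_lat : IsZLattice ℝ (lat V K L₁ L₂) where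
  span_top := by
    refine Submodule.eq_top_iff'.mpr fun v => ?_
    obtain ⟨y, hy, z, hz, rfl⟩ := K.exists_add_mem_mem_orthogonal v
    refine Submodule.add_mem _ ?_ ?_
    · have h1 : (⟨y, hy⟩ : K) ∈ Submodule.span ℝ (L₁ : Set K) := by
        rw [IsZLattice.span_top]; trivial
      have h2 : Submodule.span ℝ (L₁ : Set K) ≤ (Submodule.span ℝ (lat V K L₁ L₂ : Set V)).comap K.subtype := by
        rw [Submodule.span_le]
        intro l hl
        exact Submodule.subset_span (coe_mem_lat₁ V K L₁ L₂ hl)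
      exact h2 h1
    · have h1 : (⟨z, hz⟩ : Kᗮ) ∈ Submodule.span ℝ (L₂ : Set Kᗮ) := by
        rw [IsZLattice.span_top]; trivial
      have h2 : Submodule.span ℝ (L₂ : Set Kᗮ) ≤ (Submodule.span ℝ (lat V K L₁ L₂ : Set V)).comap Kᗮ.subtype := by
        rw [Submodule.span_le]
        intro l hl
        exact Submodule.subset_span (coe_mem_lat₂ V K L₁ L₂ hl)
      exact h2 h1

end Lattice

section Arith

variable (V : Type) [NormedAddCommGroup V] [InnerProductSpace ℝ V] (K : Submodule ℝ V) (L₁ : Submodule ℤ K)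
  (L₂ : Submodule ℤ Kᗮ) (m : ℤ)

/-- `m b ∈ L₁*` (duality inside `K`) gives `m b ∈ L*` in `V`: `⟪b, l₁ + l₂⟫ = ⟪b, l₁⟫` as `b ⊥ L₂`. -/
theorem smul_coe_mem_dualLattice₁ {b : K} (hb : (m : ℝ) • b ∈ PoissonSummation.dualLattice L₁) :
    (m : ℝ) • (b : V) ∈ PoissonSummation.dualLattice (lat V K L₁ L₂) := by
  rw [PoissonSummation.mem_dualLattice] at hb ⊢
  intro v hv
  obtain ⟨l₁, hl₁, l₂, hl₂, rfl⟩ := (mem_lat V K L₁ L₂).mp hv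
  obtain ⟨n, hn⟩ := hb l₁ hl₁
  refine ⟨n, ?_⟩
  rw [inner_add_right, Submodule.inner_right_of_mem_orthogonal (K.smul_mem (m : ℝ) b.2) l₂.2, add_zero, hn,
    Submodule.coe_inner, Submodule.coe_smul]

/-- Symmetrically for `Kᗮ`. -/
theorem smul_coe_mem_dualLattice₂ {b : Kᗮ} (hb : (m : ℝ) • b ∈ PoissonSummation.dualLattice L₂) :
    (m : ℝ) • (b : V) ∈ PoissonSummation.dualLattice (lat V K L₁ L₂) := by
  rw [PoissonSummation.mem_dualLattice] at hb ⊢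
  intro v hv
  obtain ⟨l₁, hl₁, l₂, hl₂, rfl⟩ := (mem_lat V K L₁ L₂).mp hv
  obtain ⟨n, hn⟩ := hb l₂ hl₂
  refine ⟨n, ?_⟩
  rw [inner_add_right, Submodule.inner_left_of_mem_orthogonal l₁.2 (Kᗮ.smul_mem (m : ℝ) b.2), zero_add, hn,
    Submodule.coe_inner, Submodule.coe_smul]

/-- **`incl₁(arith K L₁ m) ≤ arith V L m`.** -/
theorem incl₁_mem_arith {γ : Heis K} (hγ : γ ∈ arith K L₁ m) : incl₁ V K γ ∈ arith V (lat V K L₁ L₂) m := by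
  obtain ⟨ha, hb, hu⟩ := hγ
  exact ⟨coe_mem_lat₁ V K L₁ L₂ ha, smul_coe_mem_dualLattice₁ V K L₁ L₂ m hb, hu⟩

/-- **`incl₂(arith Kᗮ L₂ m) ≤ arith V L m`.** -/
theorem incl₂_mem_arith {γ : Heis Kᗮ} (hγ : γ ∈ arith Kᗮ L₂ m) : incl₂ V K γ ∈ arith V (lat V K L₁ L₂) m := by
  obtain ⟨ha, hb, hu⟩ := hγ
  exact ⟨coe_mem_lat₂ V K L₁ L₂ ha, smul_coe_mem_dualLattice₂ V K L₁ L₂ m hb, hu⟩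

end Arith

/-! ## 3. The dual-pair Weil theta model -/

section Model

variable (V : Type) [NormedAddCommGroup V] [InnerProductSpace ℝ V] [FiniteDimensional ℝ V] [MeasurableSpace V]
  [BorelSpace V] (K : Submodule ℝ V) (L₁ : Submodule ℤ K) [DiscreteTopology L₁] (L₂ : Submodule ℤ Kᗮ)
  [DiscreteTopology L₂] (m : ℤ)

/-- **The dual-pair Weil theta model** `WeilThetaModel (Heis K) (arith K L₁ m) (Heis Kᗮ) (arith Kᗮ L₂ m)`: `G_U ↦ Heis K`,
`U(W) ↦ Heis Kᗮ`, both acting on `𝓢(V, ℂ)` through `Heis V` by pv14-g5's weight-`m` Schrödinger representation (datum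
`datumH V (L₁ ⊕ L₂) m`), splitting `pairSplitting`, `SK := univ`. -/
def pairModel : HodgeCM.WeilThetaModel (Heis K) (arith K L₁ m) (Heis Kᗮ) (arith Kᗮ L₂ m) where
  W := datumH V (lat V K L₁ L₂) m
  act_one := repCLM_one_apply V m
  theta_act := thetaH_repCLM V (lat V K L₁ L₂) m
  actionContinuous := actionContinuousH V (lat V K L₁ L₂) m
  thetaContinuousInvariant := thetaContinuousInvariantH V (lat V K L₁ L₂) m
  dist_cont := continuous_thetaH_left V (lat V K L₁ L₂) m 1
  s := pairSplitting V K
  s_cont := Heis.continuous_pairHom _ _ (inner_coe_coe V K)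
  s_rat := fun _ h₁ _ h₂ =>
    (arith V (lat V K L₁ L₂) m).mul_mem (incl₁_mem_arith V K L₁ L₂ m h₁) (incl₂_mem_arith V K L₁ L₂ m h₂)
  SK := Set.univ
  SK_stable := fun _ _ _ => Set.mem_univ _

/-- (Ported verbatim from the HodgeCMPerL package; no docstring in the source.) -/
@[simp] theorem pairModel_W : (pairModel V K L₁ L₂ m).W = datumH V (lat V K L₁ L₂) m := rfl

/-- (Ported verbatim from the HodgeCMPerL package; no docstring in the source.) -/
@[simp] theorem pairModel_SK : (pairModel V K L₁ L₂ m).SK = Set.univ := rfl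

/-- (Ported verbatim from the HodgeCMPerL package; no docstring in the source.) -/
@[simp] theorem pairModel_s_apply (p : Heis K × Heis Kᗮ) :
    (pairModel V K L₁ L₂ m).s p = incl₁ V K p.1 * incl₂ V K p.2 := rfl

/-- `ω(y)Φ = ρ_m(incl₂ y)Φ`: the Weil action of `U(W) = Heis Kᗮ` IS the Schrödinger representation through `Heis V`. -/
theorem pairModel_omg (y : Heis Kᗮ) (Φ : (pairModel V K L₁ L₂ m).SK) :
    ((pairModel V K L₁ L₂ m).omg y Φ).1 = repCLM V m (incl₂ V K y) Φ.1 := by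
  have h1 : (pairModel V K L₁ L₂ m).s (1, y) = incl₂ V K y := by
    rw [pairModel_s_apply, map_one, one_mul]
  rw [WeilThetaModel.coe_omg, h1]
  exact datumH_act V (lat V K L₁ L₂) m _ Φ.1


-- port_pkg: scope closed for this part
end Model
end HeisenbergPair
end SchwartzWeil
end HodgeCM
end
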